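import Summits.ABC.IUTFork.Joshi.TestDictionaryCalibrationPlacewise
import HarnessLib

/-!
# Branch E TEST vs S — the calibration across places, VII: place-separability is a property of (Ind1) ALONE

Record file of the abc-iut cell, branch E (rung LADDER-ABC:A2.E; seat abc-iut-E-t42 gen 2, row T-42h; sequel of
`Joshi/TestDictionaryCalibrationPlacewise.lean` p442044; cross-lane twin of abc-iut-D1-cx's «(Ind2) is local in `v_ℚ`»,
`Charitable/Thm311D1PerPlaceSeparationSubAllP.lean` p443299). **No side is taken** on [IUTchIII] Cor. 3.12 or on any author; typed ≠
proved; located, not adjudicated.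

THE EXACT FORM OF THE HYPOTHESIS. Parts I–VI located the excess of the ONE-indeterminacy forms (X-01 / IndTranslate) over S-as-typed in
(Ind1)'s capsule permutation, by WITNESSES (two-place indices). THIS FILE turns the location into an EQUIVALENCE, under the group
hypotheses of abc-iut-c312's `Thm311SigProofs` on the signature — (HI) Ism closed under `*`, `⁻¹`; (HS) strip-automorphisms closed under
`*`, `⁻¹`; (HN) strip-automorphisms normalise Ism (all satisfied by print's groups and by every instantiation of record) — using
abc-iut-c312's product decomposition `closure_eq_Ind2Family_mul_Ind1Family` («every indeterminacy is ONE (Ind1)-family followed by ONE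
(Ind2)-family», Dupuy–Hilado §4.11 `U_Θ := Ind2(Ind1(−))`):
* `Ind1PlaceComponentsMem L` := the single-place component of every (Ind1)-FAMILY lies in `⟨(Ind1) ∪ (Ind2)⟩` («a procession
  automorphism may be applied at ONE place at a time, up to indeterminacies») — TEST SHAPE, never asserted;
* `placeComponent_mul` — single-place components are multiplicative;
* **`placeComponentsMem_iff_ind1`** (HI, HS, HN): part V's `PlaceComponentsMem L` ⟺ `Ind1PlaceComponentsMem L` ((Ind2)-components are
  always members, part V `placeComponent_mem_Ind2Family`);
* **`indPlaceSeparable_iff_ind1PlaceComponentsMem`** (HI, HS, HN, finitely many places): `IndPlaceSeparable L` ⟺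
  `Ind1PlaceComponentsMem L` — so, with part I §2, the calibration «X-01's hypothesis set ⟺ S» holds at EXACTLY those (finite) indices at
  which (Ind1) may be applied one place at a time modulo `⟨(Ind1) ∪ (Ind2)⟩`; (Ind2) — whatever Ism is — never matters
  (cf. part VI `not_indPlaceSeparable_anyIsm`: on `ℚ²` carriers at two places it fails for every Ism);
* `TwoPlace.not_ind1PlaceComponentsMem` — the rigid two-place instance (the witness of parts I/V IS an (Ind1)-family).
Print-facing question unchanged (E-cx-2 INFO 1: ONE automorphism of the procession for all places ⇒ the uniform form is the print-shaped
one). [claim: Mochizuki2012, status: disputed] [claim: Joshi2024ATS3, status: disputed] [cite: DupuyHilado2025, §4.11]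
-/

noncomputable section

open Set

namespace Summit.ABC.IUTFork.Joshi

open Thm311 Cor312 Cor312Vol Literature.IUT.LogThetaLattice
open scoped Pointwise

section Ind1Local

variable {T : ThetaIndex} (L : LogShells T)

/-- **`Ind1PlaceComponentsMem L` — «(Ind1) may be applied ONE place at a time (modulo indeterminacies)»**: the single-place component
(part V `LogShells.placeComponent`) of every (Ind1)-family lies in `⟨(Ind1) ∪ (Ind2)⟩`. TEST SHAPE on the signature, never asserted; no
author claims it ([IUTchIII] Thm. 3.11 (i) p. 154 prints (Ind1) as automorphisms of the procession of 𝒟⊢-prime-strips — ONE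
permutation of `S^±_{j+1}` for all `v_ℚ`, `LogShells.Ind1`). [claim: Mochizuki2012, status: disputed] -/
@[claim "Mochizuki2012" "disputed"]
def Ind1PlaceComponentsMem : Prop :=
  ∀ Φ ∈ L.Ind1Family, ∀ vQ₀ : T.VQ, L.placeComponent Φ vQ₀ ∈ Subgroup.closure (L.Ind1Family ∪ L.Ind2Family)

/-- Single-place components are multiplicative. [folklore] -/
theorem placeComponent_mul (Φ Ψ : L.PacketAut) (vQ₀ : T.VQ) :
    L.placeComponent (Φ * Ψ) vQ₀ = L.placeComponent Φ vQ₀ * L.placeComponent Ψ vQ₀ := by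
  funext j vQ
  rw [Pi.mul_apply, Pi.mul_apply]
  by_cases h : vQ = vQ₀
  · subst h
    rw [L.placeComponent_self, L.placeComponent_self, L.placeComponent_self, Pi.mul_apply, Pi.mul_apply]
  · rw [L.placeComponent_of_ne _ h, L.placeComponent_of_ne _ h, L.placeComponent_of_ne _ h]
    rfl

variable {L}

/-- `PlaceComponentsMem ⟹ Ind1PlaceComponentsMem` (restriction to the (Ind1)-families), at every index, no hypothesis. [folklore] -/
theorem ind1PlaceComponentsMem_of_placeComponentsMem (h : L.PlaceComponentsMem) : Ind1PlaceComponentsMem L :=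
  fun Φ hΦ vQ₀ => h Φ (Subgroup.subset_closure (Or.inl hΦ)) vQ₀

/-- **`placeComponentsMem_iff_ind1`** — under (HI), (HS), (HN): single-place components of ALL members of `⟨(Ind1) ∪ (Ind2)⟩` are members
IFF those of the (Ind1)-families are. Proof: a member is `Φ₂ * Φ₁` (abc-iut-c312 `closure_eq_Ind2Family_mul_Ind1Family`), components are
multiplicative, and (Ind2)-components are (Ind2)-families (part V). [folklore] -/
theorem placeComponentsMem_iff_ind1
    (hS : ∀ v, ∀ a ∈ L.stripAut v, ∀ b ∈ L.stripAut v, a * b ∈ L.stripAut v) (hS' : ∀ v, ∀ a ∈ L.stripAut v, a⁻¹ ∈ L.stripAut v)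
    (hN : ∀ v, ∀ a ∈ L.stripAut v, ∀ g ∈ L.ism v, a * g * a⁻¹ ∈ L.ism v)
    (hI : ∀ v, ∀ a ∈ L.ism v, ∀ b ∈ L.ism v, a * b ∈ L.ism v) (hI' : ∀ v, ∀ a ∈ L.ism v, a⁻¹ ∈ L.ism v) :
    L.PlaceComponentsMem ↔ Ind1PlaceComponentsMem L := by
  refine ⟨ind1PlaceComponentsMem_of_placeComponentsMem, fun h1 Φ hΦ vQ₀ => ?_⟩
  have hdec := LogShells.closure_eq_Ind2Family_mul_Ind1Family (hS := hS) (hS' := hS') (hN := hN) hI hI'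
  have hΦ' : Φ ∈ L.Ind2Family * L.Ind1Family := by rw [← hdec]; exact hΦ
  obtain ⟨Φ₂, hΦ₂, Φ₁, hΦ₁, rfl⟩ := hΦ'
  rw [placeComponent_mul]
  exact mul_mem (Subgroup.subset_closure (Or.inr (L.placeComponent_mem_Ind2Family hΦ₂ vQ₀))) (h1 Φ₁ hΦ₁ vQ₀)

/-- **`indPlaceSeparable_iff_ind1PlaceComponentsMem` — PLACE-SEPARABILITY IS A PROPERTY OF (Ind1) ALONE**: under (HI), (HS), (HN), at
every index with finitely many places, `⟨(Ind1) ∪ (Ind2)⟩` is place-separable IFF every procession automorphism ((Ind1)-family) may be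
applied one place at a time modulo indeterminacies. With part I §2: X-01's hypothesis set ⟺ S holds at exactly these indices (and at
all (Ind)-trivial pinned settings, part IV); Ism plays no role. [claim: Mochizuki2012, status: disputed] -/
theorem indPlaceSeparable_iff_ind1PlaceComponentsMem [Finite T.VQ]
    (hS : ∀ v, ∀ a ∈ L.stripAut v, ∀ b ∈ L.stripAut v, a * b ∈ L.stripAut v) (hS' : ∀ v, ∀ a ∈ L.stripAut v, a⁻¹ ∈ L.stripAut v)
    (hN : ∀ v, ∀ a ∈ L.stripAut v, ∀ g ∈ L.ism v, a * g * a⁻¹ ∈ L.ism v)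
    (hI : ∀ v, ∀ a ∈ L.ism v, ∀ b ∈ L.ism v, a * b ∈ L.ism v) (hI' : ∀ v, ∀ a ∈ L.ism v, a⁻¹ ∈ L.ism v) :
    IndPlaceSeparable L ↔ Ind1PlaceComponentsMem L :=
  indPlaceSeparable_iff_placeComponentsMem.trans (placeComponentsMem_iff_ind1 hS hS' hN hI hI')

/-- The hypothesis-free direction: place-separable ⟹ (Ind1) may be applied one place at a time (every index). [folklore] -/
theorem ind1PlaceComponentsMem_of_indPlaceSeparable (hsep : IndPlaceSeparable L) : Ind1PlaceComponentsMem L :=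
  ind1PlaceComponentsMem_of_placeComponentsMem (placeComponentsMem_of_indPlaceSeparable hsep)

end Ind1Local

/-! ## The rigid two-place instance through the equivalence -/

namespace TwoPlace

/-- At part I's rigid two-place shells the diagonal swap (Ind1)-family can NOT be applied at `v_ℚ¹` alone (part V `not_placeComponentsMem`,
restricted to (Ind1) — the witness IS an (Ind1)-family). [claim: Mochizuki2012, status: disputed] -/
theorem not_ind1PlaceComponentsMem : ¬ Ind1PlaceComponentsMem shells := fun h =>
  mixed_not_mem (mixed_eq_placeComponent ▸ h _ (shells.capsPermFamily_mem_Ind1Family sw) true)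

end TwoPlace

end Summit.ABC.IUTFork.Joshi

end
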